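import Literature.NumberTheory.EllipticCurves.GlobalMinimalModelNumberFieldBaseChangeProofs
import HarnessLib

/-!
# The 18 DEPTH-TABLE curves (Cremona's rank-2 curves of conductor `≤ 1000`) are given by GLOBAL
# MINIMAL equations — unconditional instance supply for the row certificates of route
# `KolyvaginDepthDoor` (crux `KolyvaginDepthSupply`, stmt-BirchSwinnertonDyer-21765)

Route-independent helper (no `Theses` import; `--supports stmt-BirchSwinnertonDyer-21765 --as
helper`); it closes nothing and says nothing about BSD. The row certificates
(`depthRow_certificate_of_two_le_rank`, `curve389a1_depthRow_certificate`,
`shaCorank_eq_zero_and_rank_eq_two_of_toricPeriod_ne_zero`) and the facts they rest on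
(Kolyvagin 1991 Thm. 4, Kim 2024 Thm. 4.26) carry the instance binder `[W.IsGloballyMinimal]`
(`frobeniusTrace`, `Zhang2014.IsKolyvaginPrime`, `levelIndex` need it). The route's CHEAPEST
FALSIFIER / instrument is the DEPTH TABLE over "the 18 Cremona rank-2 curves `N ≤ 1000` (389a1 …
997c1)"; their `2 ≤ rank_ℤ E(ℚ)` is kernel-certified in the tree
(`Rank2Observatory.KernelCerts001–003.C<label>.two_le_rank`, on the literal
`(⟨a₁,…,a₆⟩ : WeierstrassCurve ℤ).map (Int.castRingHom ℚ)`). This file supplies, on the SAME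
literals, the global minimality — unconditionally, by one generic criterion:

* `isGloballyMinimal_map_int_of_natAbs_Δ_lt` — an integer Weierstrass equation with
  `0 < |Δ| < 3¹² = 531441` and `2¹² = 4096 ∤ Δ` is a global minimal model over `ℚ` (no prime has
  `q¹² ∣ Δ`, so Silverman's `Δ`-criterion `isGloballyMinimal_baseChange_int_of_finrank_mul_lt_twelve`
  with `k = 11` applies; AEC VII.1 Rem. 1.1, VIII.8). All three hypotheses are `decide`d by the
  kernel on literals.
* `isGloballyMinimal_c389a1`, …, `isGloballyMinimal_c997c1` — the 18 instances (models and
  discriminants from Cremona's Table 1; `Δ ∈ {389, −433, 892, −563, −571, −643, −3275, −21248,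
  −2043, 4949, 709, 5744, −1588, −15523, 3664, −60416, 997, 997}`).
* (appended) `neZero_conductorNorm_of_isElliptic` and `isElliptic_c389a1`, …, `isElliptic_c997c1`
  (`Δ ≠ 0` read through `map_Δ`, as in `Rank2.isElliptic_map_of_Δ_ne_zero`) — the other two instance binders
  (`[W.IsElliptic]`, `[NeZero (W.conductorNorm ℤ)]`) of the row certificates, unconditionally.
  RECIPE for a row on curve `c` (16 of the 18 have a kernel rank certificate
  `Rank2Observatory.KernelCerts00k.C<c>.two_le_rank`, 389a1 as `Curve389a1.two_le_mordellWeilRank`;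
  817a1 and 997b1 have a non-integral listed generator and no kernel certificate yet):
  `haveI := isElliptic_c<c>; haveI := isGloballyMinimal_c<c>; haveI := neZero_conductorNorm_of_isElliptic _;
  exact depthRow_certificate_of_two_le_rank hF _ KernelCerts00k.C<c>.two_le_rank …`.

References: [CremonaAlgorithms1997] J. E. Cremona, *Algorithms for Modular Elliptic Curves* (2nd
ed. 1997), Table 1; [SilvermanAEC2009] VII.1 Remark 1.1, VIII.8.
-/

set_option linter.dupNamespace false

noncomputable section

namespace Summit.BirchSwinnertonDyer.BirchSwinnertonDyer.Theorems.KolyvaginDepthDoor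

open Literature.NumberTheory.EllipticCurves WeierstrassCurve

/-- **Silverman's `Δ`-criterion, small-discriminant form (unconditional).** An integer Weierstrass
equation `W₀` with `Δ ≠ 0`, `|Δ| < 3¹² = 531441` and `4096 = 2¹² ∤ Δ` defines a GLOBAL MINIMAL model
over `ℚ`: a prime `q` with `q¹² ∣ Δ` would have `q¹² ≤ |Δ| < 3¹²`, so `q = 2`, excluded; hence
`ord_q Δ < 12` at every prime and the integral equation is minimal everywhere
(`isGloballyMinimal_baseChange_int_of_finrank_mul_lt_twelve` with `k = 11`, `[ℚ : ℚ] = 1`).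
[cite: SilvermanAEC2009, VII.1 Remark 1.1 and VIII.8] -/
theorem isGloballyMinimal_map_int_of_natAbs_Δ_lt (W₀ : WeierstrassCurve ℤ) (h0 : W₀.Δ ≠ 0)
    (hlt : W₀.Δ.natAbs < 531441) (h2 : ¬ ((4096 : ℤ) ∣ W₀.Δ)) :
    (W₀.map (Int.castRingHom ℚ)).IsGloballyMinimal := by
  have hbc : W₀.map (Int.castRingHom ℚ) = W₀.baseChange ℚ := by
    ext <;> simp [WeierstrassCurve.baseChange, WeierstrassCurve.map]
  rw [hbc]
  refine isGloballyMinimal_baseChange_int_of_finrank_mul_lt_twelve W₀ ℚ 11 (fun q hq hdvd ↦ ?_)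
    (by rw [Module.finrank_self]; norm_num)
  have hpos : 0 < W₀.Δ.natAbs := Int.natAbs_pos.mpr h0
  have h1 : q ^ 12 ∣ W₀.Δ.natAbs := by
    have := Int.natAbs_dvd_natAbs.mpr hdvd
    simpa [Int.natAbs_pow] using this
  have hle : q ^ 12 ≤ W₀.Δ.natAbs := Nat.le_of_dvd hpos h1
  rcases Nat.lt_or_ge q 3 with hq3 | hq3
  · have hq2 : q = 2 := by
      have := hq.two_le
      omega
    subst hq2
    exact h2 (by exact_mod_cast hdvd)
  · have h312 : 3 ^ 12 ≤ q ^ 12 := Nat.pow_le_pow_left hq3 12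
    norm_num at h312
    omega

/-- **Cremona's `389a1` = `[0,1,1,-2,0]` (`N = 389`, `Δ = 389`) is a global minimal equation over `ℚ`**
(unconditional; `|Δ| < 3¹²`, `2¹² ∤ Δ`, kernel-checked). One of the 18 depth-table curves.
[cite: CremonaAlgorithms1997, Table 1 (389A1)] [cite: SilvermanAEC2009, VII.1 Remark 1.1 and VIII.8] -/
theorem isGloballyMinimal_c389a1 :
    ((⟨0, 1, 1, -2, 0⟩ : WeierstrassCurve ℤ).map (Int.castRingHom ℚ)).IsGloballyMinimal :=
  isGloballyMinimal_map_int_of_natAbs_Δ_lt _ (by decide +kernel) (by decide +kernel) (by decide +kernel)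

/-- **Cremona's `433a1` = `[1,0,0,0,1]` (`N = 433`, `Δ = -433`) is a global minimal equation over `ℚ`**
(unconditional; `|Δ| < 3¹²`, `2¹² ∤ Δ`, kernel-checked). One of the 18 depth-table curves.
[cite: CremonaAlgorithms1997, Table 1 (433A1)] [cite: SilvermanAEC2009, VII.1 Remark 1.1 and VIII.8] -/
theorem isGloballyMinimal_c433a1 :
    ((⟨1, 0, 0, 0, 1⟩ : WeierstrassCurve ℤ).map (Int.castRingHom ℚ)).IsGloballyMinimal :=
  isGloballyMinimal_map_int_of_natAbs_Δ_lt _ (by decide +kernel) (by decide +kernel) (by decide +kernel)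

/-- **Cremona's `446d1` = `[1,-1,0,-4,4]` (`N = 446`, `Δ = 892`) is a global minimal equation over `ℚ`**
(unconditional; `|Δ| < 3¹²`, `2¹² ∤ Δ`, kernel-checked). One of the 18 depth-table curves.
[cite: CremonaAlgorithms1997, Table 1 (446D1)] [cite: SilvermanAEC2009, VII.1 Remark 1.1 and VIII.8] -/
theorem isGloballyMinimal_c446d1 :
    ((⟨1, -1, 0, -4, 4⟩ : WeierstrassCurve ℤ).map (Int.castRingHom ℚ)).IsGloballyMinimal :=
  isGloballyMinimal_map_int_of_natAbs_Δ_lt _ (by decide +kernel) (by decide +kernel) (by decide +kernel)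

/-- **Cremona's `563a1` = `[1,1,1,-15,16]` (`N = 563`, `Δ = -563`) is a global minimal equation over `ℚ`**
(unconditional; `|Δ| < 3¹²`, `2¹² ∤ Δ`, kernel-checked). One of the 18 depth-table curves.
[cite: CremonaAlgorithms1997, Table 1 (563A1)] [cite: SilvermanAEC2009, VII.1 Remark 1.1 and VIII.8] -/
theorem isGloballyMinimal_c563a1 :
    ((⟨1, 1, 1, -15, 16⟩ : WeierstrassCurve ℤ).map (Int.castRingHom ℚ)).IsGloballyMinimal :=
  isGloballyMinimal_map_int_of_natAbs_Δ_lt _ (by decide +kernel) (by decide +kernel) (by decide +kernel)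

/-- **Cremona's `571b1` = `[0,1,1,-4,2]` (`N = 571`, `Δ = -571`) is a global minimal equation over `ℚ`**
(unconditional; `|Δ| < 3¹²`, `2¹² ∤ Δ`, kernel-checked). One of the 18 depth-table curves.
[cite: CremonaAlgorithms1997, Table 1 (571B1)] [cite: SilvermanAEC2009, VII.1 Remark 1.1 and VIII.8] -/
theorem isGloballyMinimal_c571b1 :
    ((⟨0, 1, 1, -4, 2⟩ : WeierstrassCurve ℤ).map (Int.castRingHom ℚ)).IsGloballyMinimal :=
  isGloballyMinimal_map_int_of_natAbs_Δ_lt _ (by decide +kernel) (by decide +kernel) (by decide +kernel)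

/-- **Cremona's `643a1` = `[1,0,0,-4,3]` (`N = 643`, `Δ = -643`) is a global minimal equation over `ℚ`**
(unconditional; `|Δ| < 3¹²`, `2¹² ∤ Δ`, kernel-checked). One of the 18 depth-table curves.
[cite: CremonaAlgorithms1997, Table 1 (643A1)] [cite: SilvermanAEC2009, VII.1 Remark 1.1 and VIII.8] -/
theorem isGloballyMinimal_c643a1 :
    ((⟨1, 0, 0, -4, 3⟩ : WeierstrassCurve ℤ).map (Int.castRingHom ℚ)).IsGloballyMinimal :=
  isGloballyMinimal_map_int_of_natAbs_Δ_lt _ (by decide +kernel) (by decide +kernel) (by decide +kernel)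

/-- **Cremona's `655a1` = `[0,0,1,-13,18]` (`N = 655`, `Δ = -3275`) is a global minimal equation over `ℚ`**
(unconditional; `|Δ| < 3¹²`, `2¹² ∤ Δ`, kernel-checked). One of the 18 depth-table curves.
[cite: CremonaAlgorithms1997, Table 1 (655A1)] [cite: SilvermanAEC2009, VII.1 Remark 1.1 and VIII.8] -/
theorem isGloballyMinimal_c655a1 :
    ((⟨0, 0, 1, -13, 18⟩ : WeierstrassCurve ℤ).map (Int.castRingHom ℚ)).IsGloballyMinimal :=
  isGloballyMinimal_map_int_of_natAbs_Δ_lt _ (by decide +kernel) (by decide +kernel) (by decide +kernel)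

/-- **Cremona's `664a1` = `[0,0,0,-7,10]` (`N = 664`, `Δ = -21248`) is a global minimal equation over `ℚ`**
(unconditional; `|Δ| < 3¹²`, `2¹² ∤ Δ`, kernel-checked). One of the 18 depth-table curves.
[cite: CremonaAlgorithms1997, Table 1 (664A1)] [cite: SilvermanAEC2009, VII.1 Remark 1.1 and VIII.8] -/
theorem isGloballyMinimal_c664a1 :
    ((⟨0, 0, 0, -7, 10⟩ : WeierstrassCurve ℤ).map (Int.castRingHom ℚ)).IsGloballyMinimal :=
  isGloballyMinimal_map_int_of_natAbs_Δ_lt _ (by decide +kernel) (by decide +kernel) (by decide +kernel)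

/-- **Cremona's `681c1` = `[0,-1,1,0,2]` (`N = 681`, `Δ = -2043`) is a global minimal equation over `ℚ`**
(unconditional; `|Δ| < 3¹²`, `2¹² ∤ Δ`, kernel-checked). One of the 18 depth-table curves.
[cite: CremonaAlgorithms1997, Table 1 (681C1)] [cite: SilvermanAEC2009, VII.1 Remark 1.1 and VIII.8] -/
theorem isGloballyMinimal_c681c1 :
    ((⟨0, -1, 1, 0, 2⟩ : WeierstrassCurve ℤ).map (Int.castRingHom ℚ)).IsGloballyMinimal :=
  isGloballyMinimal_map_int_of_natAbs_Δ_lt _ (by decide +kernel) (by decide +kernel) (by decide +kernel)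

/-- **Cremona's `707a1` = `[0,1,1,-12,12]` (`N = 707`, `Δ = 4949`) is a global minimal equation over `ℚ`**
(unconditional; `|Δ| < 3¹²`, `2¹² ∤ Δ`, kernel-checked). One of the 18 depth-table curves.
[cite: CremonaAlgorithms1997, Table 1 (707A1)] [cite: SilvermanAEC2009, VII.1 Remark 1.1 and VIII.8] -/
theorem isGloballyMinimal_c707a1 :
    ((⟨0, 1, 1, -12, 12⟩ : WeierstrassCurve ℤ).map (Int.castRingHom ℚ)).IsGloballyMinimal :=
  isGloballyMinimal_map_int_of_natAbs_Δ_lt _ (by decide +kernel) (by decide +kernel) (by decide +kernel)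

/-- **Cremona's `709a1` = `[0,-1,1,-2,0]` (`N = 709`, `Δ = 709`) is a global minimal equation over `ℚ`**
(unconditional; `|Δ| < 3¹²`, `2¹² ∤ Δ`, kernel-checked). One of the 18 depth-table curves.
[cite: CremonaAlgorithms1997, Table 1 (709A1)] [cite: SilvermanAEC2009, VII.1 Remark 1.1 and VIII.8] -/
theorem isGloballyMinimal_c709a1 :
    ((⟨0, -1, 1, -2, 0⟩ : WeierstrassCurve ℤ).map (Int.castRingHom ℚ)).IsGloballyMinimal :=
  isGloballyMinimal_map_int_of_natAbs_Δ_lt _ (by decide +kernel) (by decide +kernel) (by decide +kernel)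

/-- **Cremona's `718b1` = `[1,0,1,-5,0]` (`N = 718`, `Δ = 5744`) is a global minimal equation over `ℚ`**
(unconditional; `|Δ| < 3¹²`, `2¹² ∤ Δ`, kernel-checked). One of the 18 depth-table curves.
[cite: CremonaAlgorithms1997, Table 1 (718B1)] [cite: SilvermanAEC2009, VII.1 Remark 1.1 and VIII.8] -/
theorem isGloballyMinimal_c718b1 :
    ((⟨1, 0, 1, -5, 0⟩ : WeierstrassCurve ℤ).map (Int.castRingHom ℚ)).IsGloballyMinimal :=
  isGloballyMinimal_map_int_of_natAbs_Δ_lt _ (by decide +kernel) (by decide +kernel) (by decide +kernel)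

/-- **Cremona's `794a1` = `[1,0,1,-3,2]` (`N = 794`, `Δ = -1588`) is a global minimal equation over `ℚ`**
(unconditional; `|Δ| < 3¹²`, `2¹² ∤ Δ`, kernel-checked). One of the 18 depth-table curves.
[cite: CremonaAlgorithms1997, Table 1 (794A1)] [cite: SilvermanAEC2009, VII.1 Remark 1.1 and VIII.8] -/
theorem isGloballyMinimal_c794a1 :
    ((⟨1, 0, 1, -3, 2⟩ : WeierstrassCurve ℤ).map (Int.castRingHom ℚ)).IsGloballyMinimal :=
  isGloballyMinimal_map_int_of_natAbs_Δ_lt _ (by decide +kernel) (by decide +kernel) (by decide +kernel)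

/-- **Cremona's `817a1` = `[0,1,1,1,6]` (`N = 817`, `Δ = -15523`) is a global minimal equation over `ℚ`**
(unconditional; `|Δ| < 3¹²`, `2¹² ∤ Δ`, kernel-checked). One of the 18 depth-table curves.
[cite: CremonaAlgorithms1997, Table 1 (817A1)] [cite: SilvermanAEC2009, VII.1 Remark 1.1 and VIII.8] -/
theorem isGloballyMinimal_c817a1 :
    ((⟨0, 1, 1, 1, 6⟩ : WeierstrassCurve ℤ).map (Int.castRingHom ℚ)).IsGloballyMinimal :=
  isGloballyMinimal_map_int_of_natAbs_Δ_lt _ (by decide +kernel) (by decide +kernel) (by decide +kernel)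

/-- **Cremona's `916c1` = `[0,0,0,-4,1]` (`N = 916`, `Δ = 3664`) is a global minimal equation over `ℚ`**
(unconditional; `|Δ| < 3¹²`, `2¹² ∤ Δ`, kernel-checked). One of the 18 depth-table curves.
[cite: CremonaAlgorithms1997, Table 1 (916C1)] [cite: SilvermanAEC2009, VII.1 Remark 1.1 and VIII.8] -/
theorem isGloballyMinimal_c916c1 :
    ((⟨0, 0, 0, -4, 1⟩ : WeierstrassCurve ℤ).map (Int.castRingHom ℚ)).IsGloballyMinimal :=
  isGloballyMinimal_map_int_of_natAbs_Δ_lt _ (by decide +kernel) (by decide +kernel) (by decide +kernel)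

/-- **Cremona's `944e1` = `[0,0,0,-19,34]` (`N = 944`, `Δ = -60416`) is a global minimal equation over `ℚ`**
(unconditional; `|Δ| < 3¹²`, `2¹² ∤ Δ`, kernel-checked). One of the 18 depth-table curves.
[cite: CremonaAlgorithms1997, Table 1 (944E1)] [cite: SilvermanAEC2009, VII.1 Remark 1.1 and VIII.8] -/
theorem isGloballyMinimal_c944e1 :
    ((⟨0, 0, 0, -19, 34⟩ : WeierstrassCurve ℤ).map (Int.castRingHom ℚ)).IsGloballyMinimal :=
  isGloballyMinimal_map_int_of_natAbs_Δ_lt _ (by decide +kernel) (by decide +kernel) (by decide +kernel)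

/-- **Cremona's `997b1` = `[0,-1,1,-5,-3]` (`N = 997`, `Δ = 997`) is a global minimal equation over `ℚ`**
(unconditional; `|Δ| < 3¹²`, `2¹² ∤ Δ`, kernel-checked). One of the 18 depth-table curves.
[cite: CremonaAlgorithms1997, Table 1 (997B1)] [cite: SilvermanAEC2009, VII.1 Remark 1.1 and VIII.8] -/
theorem isGloballyMinimal_c997b1 :
    ((⟨0, -1, 1, -5, -3⟩ : WeierstrassCurve ℤ).map (Int.castRingHom ℚ)).IsGloballyMinimal :=
  isGloballyMinimal_map_int_of_natAbs_Δ_lt _ (by decide +kernel) (by decide +kernel) (by decide +kernel)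

/-- **Cremona's `997c1` = `[0,-1,1,-24,54]` (`N = 997`, `Δ = 997`) is a global minimal equation over `ℚ`**
(unconditional; `|Δ| < 3¹²`, `2¹² ∤ Δ`, kernel-checked). One of the 18 depth-table curves.
[cite: CremonaAlgorithms1997, Table 1 (997C1)] [cite: SilvermanAEC2009, VII.1 Remark 1.1 and VIII.8] -/
theorem isGloballyMinimal_c997c1 :
    ((⟨0, -1, 1, -24, 54⟩ : WeierstrassCurve ℤ).map (Int.castRingHom ℚ)).IsGloballyMinimal :=
  isGloballyMinimal_map_int_of_natAbs_Δ_lt _ (by decide +kernel) (by decide +kernel) (by decide +kernel)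

/-! ## Appended: the same 18 equations are ELLIPTIC (`Δ ≠ 0`) and have `N_E ≠ 0` — the other two
instance binders of the row certificates, unconditionally -/

/-- For an elliptic curve over `ℚ` the conductor norm is non-zero (`conductorNorm_pos_holds`), as a
`NeZero` fact for the instance binder of the row certificates. [folklore] -/
theorem neZero_conductorNorm_of_isElliptic (W : WeierstrassCurve ℚ) [W.IsElliptic] :
    NeZero (W.conductorNorm ℤ) :=
  ⟨(W.conductorNorm_pos_holds).ne'⟩

/-- `389a1` = `[0,1,1,-2,0]` is an elliptic curve over `ℚ` (`Δ = 389 ≠ 0`, kernel-checked).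
[cite: CremonaAlgorithms1997, Table 1 (389a1)] -/
theorem isElliptic_c389a1 : ((⟨0, 1, 1, -2, 0⟩ : WeierstrassCurve ℤ).map (Int.castRingHom ℚ)).IsElliptic :=
  by
  rw [WeierstrassCurve.isElliptic_iff, WeierstrassCurve.map_Δ, isUnit_iff_ne_zero, eq_intCast,
    Int.cast_ne_zero]
  decide +kernel

/-- `433a1` = `[1,0,0,0,1]` is an elliptic curve over `ℚ` (`Δ = -433 ≠ 0`, kernel-checked).
[cite: CremonaAlgorithms1997, Table 1 (433a1)] -/
theorem isElliptic_c433a1 : ((⟨1, 0, 0, 0, 1⟩ : WeierstrassCurve ℤ).map (Int.castRingHom ℚ)).IsElliptic :=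
  by
  rw [WeierstrassCurve.isElliptic_iff, WeierstrassCurve.map_Δ, isUnit_iff_ne_zero, eq_intCast,
    Int.cast_ne_zero]
  decide +kernel

/-- `446d1` = `[1,-1,0,-4,4]` is an elliptic curve over `ℚ` (`Δ = 892 ≠ 0`, kernel-checked).
[cite: CremonaAlgorithms1997, Table 1 (446d1)] -/
theorem isElliptic_c446d1 : ((⟨1, -1, 0, -4, 4⟩ : WeierstrassCurve ℤ).map (Int.castRingHom ℚ)).IsElliptic :=
  by
  rw [WeierstrassCurve.isElliptic_iff, WeierstrassCurve.map_Δ, isUnit_iff_ne_zero, eq_intCast,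
    Int.cast_ne_zero]
  decide +kernel

/-- `563a1` = `[1,1,1,-15,16]` is an elliptic curve over `ℚ` (`Δ = -563 ≠ 0`, kernel-checked).
[cite: CremonaAlgorithms1997, Table 1 (563a1)] -/
theorem isElliptic_c563a1 : ((⟨1, 1, 1, -15, 16⟩ : WeierstrassCurve ℤ).map (Int.castRingHom ℚ)).IsElliptic :=
  by
  rw [WeierstrassCurve.isElliptic_iff, WeierstrassCurve.map_Δ, isUnit_iff_ne_zero, eq_intCast,
    Int.cast_ne_zero]
  decide +kernel

/-- `571b1` = `[0,1,1,-4,2]` is an elliptic curve over `ℚ` (`Δ = -571 ≠ 0`, kernel-checked).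
[cite: CremonaAlgorithms1997, Table 1 (571b1)] -/
theorem isElliptic_c571b1 : ((⟨0, 1, 1, -4, 2⟩ : WeierstrassCurve ℤ).map (Int.castRingHom ℚ)).IsElliptic :=
  by
  rw [WeierstrassCurve.isElliptic_iff, WeierstrassCurve.map_Δ, isUnit_iff_ne_zero, eq_intCast,
    Int.cast_ne_zero]
  decide +kernel

/-- `643a1` = `[1,0,0,-4,3]` is an elliptic curve over `ℚ` (`Δ = -643 ≠ 0`, kernel-checked).
[cite: CremonaAlgorithms1997, Table 1 (643a1)] -/
theorem isElliptic_c643a1 : ((⟨1, 0, 0, -4, 3⟩ : WeierstrassCurve ℤ).map (Int.castRingHom ℚ)).IsElliptic :=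
  by
  rw [WeierstrassCurve.isElliptic_iff, WeierstrassCurve.map_Δ, isUnit_iff_ne_zero, eq_intCast,
    Int.cast_ne_zero]
  decide +kernel

/-- `655a1` = `[0,0,1,-13,18]` is an elliptic curve over `ℚ` (`Δ = -3275 ≠ 0`, kernel-checked).
[cite: CremonaAlgorithms1997, Table 1 (655a1)] -/
theorem isElliptic_c655a1 : ((⟨0, 0, 1, -13, 18⟩ : WeierstrassCurve ℤ).map (Int.castRingHom ℚ)).IsElliptic :=
  by
  rw [WeierstrassCurve.isElliptic_iff, WeierstrassCurve.map_Δ, isUnit_iff_ne_zero, eq_intCast,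
    Int.cast_ne_zero]
  decide +kernel

/-- `664a1` = `[0,0,0,-7,10]` is an elliptic curve over `ℚ` (`Δ = -21248 ≠ 0`, kernel-checked).
[cite: CremonaAlgorithms1997, Table 1 (664a1)] -/
theorem isElliptic_c664a1 : ((⟨0, 0, 0, -7, 10⟩ : WeierstrassCurve ℤ).map (Int.castRingHom ℚ)).IsElliptic :=
  by
  rw [WeierstrassCurve.isElliptic_iff, WeierstrassCurve.map_Δ, isUnit_iff_ne_zero, eq_intCast,
    Int.cast_ne_zero]
  decide +kernel

/-- `681c1` = `[0,-1,1,0,2]` is an elliptic curve over `ℚ` (`Δ = -2043 ≠ 0`, kernel-checked).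
[cite: CremonaAlgorithms1997, Table 1 (681c1)] -/
theorem isElliptic_c681c1 : ((⟨0, -1, 1, 0, 2⟩ : WeierstrassCurve ℤ).map (Int.castRingHom ℚ)).IsElliptic :=
  by
  rw [WeierstrassCurve.isElliptic_iff, WeierstrassCurve.map_Δ, isUnit_iff_ne_zero, eq_intCast,
    Int.cast_ne_zero]
  decide +kernel

/-- `707a1` = `[0,1,1,-12,12]` is an elliptic curve over `ℚ` (`Δ = 4949 ≠ 0`, kernel-checked).
[cite: CremonaAlgorithms1997, Table 1 (707a1)] -/
theorem isElliptic_c707a1 : ((⟨0, 1, 1, -12, 12⟩ : WeierstrassCurve ℤ).map (Int.castRingHom ℚ)).IsElliptic :=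
  by
  rw [WeierstrassCurve.isElliptic_iff, WeierstrassCurve.map_Δ, isUnit_iff_ne_zero, eq_intCast,
    Int.cast_ne_zero]
  decide +kernel

/-- `709a1` = `[0,-1,1,-2,0]` is an elliptic curve over `ℚ` (`Δ = 709 ≠ 0`, kernel-checked).
[cite: CremonaAlgorithms1997, Table 1 (709a1)] -/
theorem isElliptic_c709a1 : ((⟨0, -1, 1, -2, 0⟩ : WeierstrassCurve ℤ).map (Int.castRingHom ℚ)).IsElliptic :=
  by
  rw [WeierstrassCurve.isElliptic_iff, WeierstrassCurve.map_Δ, isUnit_iff_ne_zero, eq_intCast,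
    Int.cast_ne_zero]
  decide +kernel

/-- `718b1` = `[1,0,1,-5,0]` is an elliptic curve over `ℚ` (`Δ = 5744 ≠ 0`, kernel-checked).
[cite: CremonaAlgorithms1997, Table 1 (718b1)] -/
theorem isElliptic_c718b1 : ((⟨1, 0, 1, -5, 0⟩ : WeierstrassCurve ℤ).map (Int.castRingHom ℚ)).IsElliptic :=
  by
  rw [WeierstrassCurve.isElliptic_iff, WeierstrassCurve.map_Δ, isUnit_iff_ne_zero, eq_intCast,
    Int.cast_ne_zero]
  decide +kernel

/-- `794a1` = `[1,0,1,-3,2]` is an elliptic curve over `ℚ` (`Δ = -1588 ≠ 0`, kernel-checked).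
[cite: CremonaAlgorithms1997, Table 1 (794a1)] -/
theorem isElliptic_c794a1 : ((⟨1, 0, 1, -3, 2⟩ : WeierstrassCurve ℤ).map (Int.castRingHom ℚ)).IsElliptic :=
  by
  rw [WeierstrassCurve.isElliptic_iff, WeierstrassCurve.map_Δ, isUnit_iff_ne_zero, eq_intCast,
    Int.cast_ne_zero]
  decide +kernel

/-- `817a1` = `[0,1,1,1,6]` is an elliptic curve over `ℚ` (`Δ = -15523 ≠ 0`, kernel-checked).
[cite: CremonaAlgorithms1997, Table 1 (817a1)] -/
theorem isElliptic_c817a1 : ((⟨0, 1, 1, 1, 6⟩ : WeierstrassCurve ℤ).map (Int.castRingHom ℚ)).IsElliptic :=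
  by
  rw [WeierstrassCurve.isElliptic_iff, WeierstrassCurve.map_Δ, isUnit_iff_ne_zero, eq_intCast,
    Int.cast_ne_zero]
  decide +kernel

/-- `916c1` = `[0,0,0,-4,1]` is an elliptic curve over `ℚ` (`Δ = 3664 ≠ 0`, kernel-checked).
[cite: CremonaAlgorithms1997, Table 1 (916c1)] -/
theorem isElliptic_c916c1 : ((⟨0, 0, 0, -4, 1⟩ : WeierstrassCurve ℤ).map (Int.castRingHom ℚ)).IsElliptic :=
  by
  rw [WeierstrassCurve.isElliptic_iff, WeierstrassCurve.map_Δ, isUnit_iff_ne_zero, eq_intCast,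
    Int.cast_ne_zero]
  decide +kernel

/-- `944e1` = `[0,0,0,-19,34]` is an elliptic curve over `ℚ` (`Δ = -60416 ≠ 0`, kernel-checked).
[cite: CremonaAlgorithms1997, Table 1 (944e1)] -/
theorem isElliptic_c944e1 : ((⟨0, 0, 0, -19, 34⟩ : WeierstrassCurve ℤ).map (Int.castRingHom ℚ)).IsElliptic :=
  by
  rw [WeierstrassCurve.isElliptic_iff, WeierstrassCurve.map_Δ, isUnit_iff_ne_zero, eq_intCast,
    Int.cast_ne_zero]
  decide +kernel

/-- `997b1` = `[0,-1,1,-5,-3]` is an elliptic curve over `ℚ` (`Δ = 997 ≠ 0`, kernel-checked).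
[cite: CremonaAlgorithms1997, Table 1 (997b1)] -/
theorem isElliptic_c997b1 : ((⟨0, -1, 1, -5, -3⟩ : WeierstrassCurve ℤ).map (Int.castRingHom ℚ)).IsElliptic :=
  by
  rw [WeierstrassCurve.isElliptic_iff, WeierstrassCurve.map_Δ, isUnit_iff_ne_zero, eq_intCast,
    Int.cast_ne_zero]
  decide +kernel

/-- `997c1` = `[0,-1,1,-24,54]` is an elliptic curve over `ℚ` (`Δ = 997 ≠ 0`, kernel-checked).
[cite: CremonaAlgorithms1997, Table 1 (997c1)] -/
theorem isElliptic_c997c1 : ((⟨0, -1, 1, -24, 54⟩ : WeierstrassCurve ℤ).map (Int.castRingHom ℚ)).IsElliptic :=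
  by
  rw [WeierstrassCurve.isElliptic_iff, WeierstrassCurve.map_Δ, isUnit_iff_ne_zero, eq_intCast,
    Int.cast_ne_zero]
  decide +kernel

end Summit.BirchSwinnertonDyer.BirchSwinnertonDyer.Theorems.KolyvaginDepthDoor

end
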